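import Mathlib
import HarnessLib
import HarnessLib.Audit
import Summits.HubbardSuperconductivity.Statement
import Literature.MathematicalPhysics.QuantumLattice.KohnLuttinger
import HarnessLib.Audit.Status.Attr

/-!
Route: IntrinsicLargeN

DORMANT since 2026-08-22T19:53:11Z (reconciler: no traction for 5.6 d (last activity item-evidence-added at 2026-08-17T04:34:11Z); parked, not closed — `ledger route dormant route-HubbardSuperconductivity-IntrinsicLargeN --off` to react) — unstaffed, not closed; items shared with open routes are served there. `ledger route dormant <id> --off` reactivates.

Route IntrinsicLargeN (card intrinsic-large-n-cooper-pairs). THESIS X (it suffices to show): there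
are U0 > 0 and a hole doping delta in (0,1/2) such that for EVERY U in (0,U0) the pure t=1, t'=0
Hubbard torus has UNIFORM fixed-N d-wave pair coherence: some a > 0 and L0 with a*L^4 <= Re<psi,
Delta_d^+ Delta_d psi> for every even L >= L0 and EVERY normalised (N_L, S^z=0)-sector ground state
psi of hubbardTorus 2 L 1 U, N_L = 2*floor((1-delta)L^2/2). No symmetry-breaking source, no
grand-canonical detour: the statement lives in the canonical sector where the summit lives, and X ->
HubbardSuperconductivity is bookkeeping (uniform bound => liminf over even sides > 0; support
UniformLROGivesSummitMatrix, the summit matrix inlined; U := U0/2; typed as the frame support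
SummitOfLargeNThesis : LargeNThesis -> UniformLROGivesSummitMatrix -> HubbardSuperconductivity, rev
3).
Lean (decl LargeNThesis): `∃ U₀ > 0, ∃ δ ∈ Ioo 0 (1/2), ∀ U ∈ Ioo 0 U₀, ∃ a > 0, ∃ L₀, ∀ L [NeZero
L], L₀ ≤ L → Even L → ∀ ψ, star ψ ⬝ᵥ ψ = 1 → IsGroundStateInSector (hubbardTorus 2 L 1 U) N_L 0 ψ →
a * L^4 ≤ (expect ((pairField dWaveFormFactor L)ᴴ * pairField dWaveFormFactor L) ψ).re` (all
constants `lean search`ed: hubbardTorus, IsGroundStateInSector, pairField, dWaveFormFactor, expect,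
szSector, Matrix.minEnergyOn, channelInf in Literature.MathematicalPhysics.QuantumLattice;
HasLongRangeOrder, halfOpenBox in Literature.Probability.LatticeModels).
MECHANISM (why X should be provable this way): at weak coupling the 2D Fermi liquid at energy scale
eps is an O(N)-vector model with N(eps) ~ (W/eps)^{1/2} angular sectors
(FeldmanMagnenRivasseauTrubowitz1993Intrinsic/Vector, ChenFrohlichSeifert1995 Ch.4); at the
superconducting scale Delta ~ W e^{-1/(alpha rho^2 U^2)} the d-wave pair sector therefore has N* =
(W/Delta)^{1/2} components, its N = infinity solution is the REDUCED d-wave BCS model (bubble-chain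
= gap equation with the Kohn-Luttinger B1g vertex), and everything else - including the T=0
Goldstone (pair-phase) sector - is suppressed by 1/N* or better. Rev 2 (2026-08-15) types the
transfer as two independently refutable halves plus solvable inputs: (crux 2) PairSectorShadow -
under certified B1g dominance, for all small U SOME sector ground state psi0 of the pure model has a
unit shadow phi in the same sector that is a near-ground state of the reduced model T - (g/L^2)
Delta_d^+Delta_d at an effective coupling g >= kappa U^2 (captures a fraction 1-epsilon of its
condensation energy) and carries at most (1-theta)^{-1} times the d-wave LRO of psi0: mean-field (N
= infinity) exactness at the Kohn-Luttinger scale, the 1/N* claim in operator form (phi = W*psi0, W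
the particle-hole correlation dressing; pp patch pair operators in Literature PatchPairOperator);
(crux 3) GroundEigenspaceHomogeneity - any two sector ground states have comparable d-wave LRO (the
exact k=0 number/phase rotor at fixed N: every-ground-state for free); (supports) ReducedBCSAnchor -
the N = infinity member has extensive sector condensation energy c(g)L^2 for every g > 0;
KohnLuttingerB1gPoint - B1g attractive and strictly dominant at some delta < 1/2 (certified numerics
on the Fermi curve); ShadowCondensation / ReducedBCSEnergyGivesLRO - three-line identities turning
near-minimal reduced-BCS energy into d-wave LRO >= (1-epsilon)(c/g)L^4. Deciding theorem: closes :
KohnLuttingerB1gPoint -> ReducedBCSAnchor -> PairSectorShadow -> GroundEigenspaceHomogeneity ->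
ShadowCondensation -> UniformLROGivesSummitMatrix -> HubbardSuperconductivity (a :=
(1-theta')(1-theta)(1-epsilon) c/g at U := min(U0,U0')/2; proved). Rev 3 (2026-08-16, gate shape
route.target-unreachable): the rank-0 target is wired into the route by two glue supports proved
sorry-free in the planner sketch - LargeNThesisOfCruxes : KohnLuttingerB1gPoint -> ReducedBCSAnchor
-> PairSectorShadow -> GroundEigenspaceHomogeneity -> ShadowCondensation -> LargeNThesis (cruxes +
inputs => X for EVERY U < min(U0,U0')) and SummitOfLargeNThesis (X => summit); closes =
SummitOfLargeNThesis o LargeNThesisOfCruxes, unchanged.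

Rationale: WHY THIS LINE. Cooper pairs at weak coupling carry a small parameter genuine bosons lack: N* =
(W/Delta)^{1/2} = e^{+1/(2 alpha rho^2 U^2)} Fermi-curve sectors at the gap scale
(FeldmanMagnenRivasseauTrubowitz1993Vector/Intrinsic: the 2D Fermi liquid is an O(N) vector model in
which only Cooper bubble chains are unsuppressed; ChenFrohlichSeifert1995 Ch. 4). N = infinity is
mean-field BCS with the Kohn-Luttinger vertex; the card's bet is that the BROKEN phase is a 1/N*
theorem implemented operator-theoretically at FIXED particle number on the torus (exact k=0
number/phase rotor + particle-hole correlation dressing / patch bosons,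
BenedikterNamPortaSchleinSeiringer2021, FalconiGiacomelliHainzlPorta2021; pp patch pair operators
and their CCR defect now in Literature PatchPairOperator.lean), so that "every sector ground state"
and "no source" come for free. Imports: constructive many-fermion sector technology
(DisertoriRivasseau2000, FeldmanKnorrerTrubowitz2004, Salmhofer1999 Sec. 4.5) down to the scale
where the B1g ladder is O(1); fixed-N zero-mode control (Seiringer2011); reduced-BCS exactness
(Richardson1963, BruPedra2013, VonDelftRalph2001). Catalogue: physical analogy WITH dictionary
(sector index = O(N) flavour, Cooper channel = (phi.phi)^2 bubble chain, gap = Gross-Neveu mass) +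
hidden solvable member (reduced BCS, Literature ReducedBCSTorus.lean) + transfer. Rev 2
(route-repair 2026-08-15): the rev-1 transfer crux OneOverNTransfer is REPLACED by its two typed,
independently refutable halves - PairSectorShadow (mean-field exactness at the Kohn-Luttinger scale
for one ground state) and GroundEigenspaceHomogeneity (the rotor's every-ground-state content) -
plus the three-line identity ShadowCondensation (halves => old transfer proved in the planner
sketch); the deciding theorem closes through the halves is proved, and the Barriers import that
dragged two unproved numerical claims into the cone is gone.
KILL TEST (card's fastest refutation, done by hand at open): Gaussian pair-phase theory S = (1/2)
Sum (kappa w^2 + rho_s q^2)|theta|^2; equal-time (1/L^2) Sum_{q != 0, |q| < 1/xi} <theta_q theta_-q>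
= (1/xi)/(4 pi sqrt(kappa rho_s)) ~ Delta/W = 1/N*^2, IR-finite in d=2 at T=0 and L-independent: the
Goldstone correction to LRO is O(1/N*^2); amplitude/high-q pair fluctuations renormalise the
effective B1g vertex at relative O(U) (the theta = O(U), epsilon = O(U) + O(1/N*) losses of
PairSectorShadow).
RANKED CRUXES (rev 2; decls of the route file):
 rank 2 PairSectorShadow [crux]: under certified B1g dominance at delta, exists kappa>0, U0>0 such
that for all U in (0,U0) there are g >= kappa U^2, epsilon<1, theta<1, L0 with: on every even torus
L >= L0 SOME normalised sector ground state psi0 of the pure model has a unit shadow phi in the same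
sector that captures the fraction (1-epsilon) of the condensation energy of H_red(g) = T - (g/L^2)
Dd^+Dd and has at most (1-theta)^{-1} times the d-wave LRO of psi0. The heart (why it might fail:
gap-prefactor suppression m^2 << Delta_BCS(kappa U^2)^2, KL gap shape far from cos-cos, no
Dd-preserving N-conserving dressing; sources FMRT1993, CFS1995 Ch.4, BNPSS2021, RKS2010).
 rank 3 GroundEigenspaceHomogeneity [crux]: under certified B1g dominance, for U < U0 and even L >=
L0 any two normalised sector ground states have comparable d-wave LRO, Re<psi,Dd^+Dd psi> >=
(1-theta) Re<psi',Dd^+Dd psi'> (why it might fail: exact degeneracies / level crossings on symmetric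
tori putting condensed and uncondensed states in one eigenspace; sources KomaTasaki1994,
Tasaki2019Tower, Seiringer2011, VonDelftRalph2001).
 OneOverNTransfer (rev-1 crux, DROPPED in rev 2 and kept in the file as a record): (KL B1g dominance
and the reduced-BCS anchor at delta) -> uniform every-ground-state d-wave LRO of the pure model for
all U < U0; it is exactly PairSectorShadow -> GroundEigenspaceHomogeneity -> ShadowCondensation ->
OneOverNTransfer (bookkeeping, proved sorry-free in the planner's Sketch.lean as
oneOverNTransfer_of_split), so the two halves replace it at the top layer (a formal --split was not
available to this seat); the deciding theorem composes the halves directly.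
 Target LargeNThesis (rank 0); Assembly (rank 1) := KohnLuttingerB1gPoint -> ReducedBCSAnchor ->
PairSectorShadow -> GroundEigenspaceHomogeneity -> ShadowCondensation -> UniformLROGivesSummitMatrix
-> HubbardSuperconductivity, literally the type of the deciding theorem closes (proved: U :=
min(U0,U0')/2, g >= kappa U^2 > 0 feeds the anchor, a := (1-theta')(1-theta)(1-epsilon) c/g, L0 :=
max; rc 0 in Sketch2.lean and certified by the gate audit).
 Glue through the target (rev 3, route.target-unreachable repair): LargeNThesisOfCruxes [support] :=
KohnLuttingerB1gPoint -> ReducedBCSAnchor -> PairSectorShadow -> GroundEigenspaceHomogeneity ->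
ShadowCondensation -> LargeNThesis - the cruxes and the N = infinity inputs conclude X itself, for
EVERY U in (0, min(U0,U0')) (same bookkeeping as closes with U universally quantified instead of the
midpoint; proved sorry-free in the planner's Sketch.lean as largeNThesisOfCruxes_holds, axioms
propext/Classical.choice/Quot.sound); SummitOfLargeNThesis [support] := LargeNThesis ->
UniformLROGivesSummitMatrix -> HubbardSuperconductivity - the frame statement X => summit (U :=
U0/2; proved in the sketch as summitOfLargeNThesis_holds). So the target is concluded by an item and
concludes the summit inside the route, and closes is literally SummitOfLargeNThesis o
LargeNThesisOfCruxes (checked as an example in the sketch).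
 Support: ReducedBCSAnchor (N = infinity member: extensive sector condensation energy of T -
(g/L^2)Dd^+Dd for all g>0, number-projected d-wave BCS trial state), KohnLuttingerB1gPoint
(certified B1g attraction + strict dominance at one delta < 1/2; interval arithmetic),
UniformLROGivesSummitMatrix (uniform bound => the summit matrix, inlined; provable now),
ReducedBCSEnergyGivesLRO and ShadowCondensation (three-line identities, provable now),
RotorPairRemoval (typed rotor signature; refutation handle, not load-bearing), LargeNThesisOfCruxes
and SummitOfLargeNThesis (glue through the target, provable now - proofs in the planner sketch).
KILL CRITERIA. PairSectorShadow refuted substantively - no sector ground state is condensed at the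
BCS value of an order-U^2 d-wave coupling (e.g. an upper bound m^2 <= o(1) Delta_BCS(kappa U^2)^2
for every kappa, or no N-conserving dressing nearly preserving Dd) -> the 1/N* line is dead: close.
GroundEigenspaceHomogeneity refuted (degenerate sector ground states with macroscopically different
d-wave LRO at weak U on large even tori) -> the every-ground-state form is unreachable by the rotor:
pivot to a generic-ground-state thesis or close. KohnLuttingerB1gPoint certified false for every
delta < 1/2 (B1g never attractive-and-leading at t'=0) -> close. RotorPairRemoval or an
Anderson-tower bound refuted at weak U -> rotor picture dead, close. ReducedBCSAnchor refuted ->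
anchor mis-typed (pivot to the quasi-free d-wave BdG torus model), not the line. A misstated
refutation of either child (normalisation, junk values of minEnergyOn on an empty sector) is
repaired by a new item, never by rewording in place.
NOT DECOMPOSED YET. No third layer (lemmas ride with --supports). Inside PairSectorShadow: (i) the
sector/multiscale flow from W to the scale where the B1g particle-particle ladder is O(1) (shared
exposure with WeakCouplingBCS crux 4; on WeakCouplingCeiling); (ii) the particle-hole correlation
dressing W and the pp-patch bosonisation with remainders O(U) + O(1/N*) uniform in L >> xi N*; (iii)
the identification of g with the Kohn-Luttinger B1g channel bottom up to normalisation (only its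
order kappa U^2 is typed). Inside GroundEigenspaceHomogeneity: the exact k=0 number/phase rotor at
fixed N and the nodal-level / open-shell bookkeeping. No quantitative U0 and no rate beyond the
one-sided BCS-scale bound built into PairSectorShadow.
CHEAPEST FALSIFIER. GroundEigenspaceHomogeneity by exact diagonalisation on small even tori: L = 4
(6 if feasible) at U in {0.5, 1, 2}, delta in {1/8, 1/4}: list the (N_L, S^z=0) ground eigenspace
(degeneracy, momenta) and the spread of <Dd^+Dd> over an orthonormal basis and random superpositions
- an order-one relative spread that does not shrink with L kills the child. For PairSectorShadow:
compare the weak-coupling pairing scale of the pure model (DengEtAl2015 diagrammatic Monte Carlo, U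
<= 4; RaghuKivelsonScalapino2010 exponents) with Delta_BCS(gamma U^2) at the same delta - an
order-of-magnitude deficit of m^2 against the BCS value of the certified KL coupling refutes the
one-sided bound. KohnLuttingerB1gPoint: one interval-arithmetic evaluation of the five channel
bottoms at delta = 1/4.

Novelty: Nearest prior art: ChenFrohlichSeifert1995 (arXiv:cond-mat/9508063) Ch.4 - BCS ground state, U(1)
breaking and Goldstone boson by "large-N techniques" with N = number of Fermi-surface sectors, in
analogy with the large-N chiral Gross-Neveu model, "leading corrections to mean-field theory"
(non-rigorous, s-wave continuum, effective-action loop expansion, no lattice, no fixed N); the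
mechanism's origin FeldmanMagnenRivasseauTrubowitz1993Intrinsic /
FeldmanMagnenRivasseauTrubowitz1993Vector (doi:10.1209/0295-5075/24/6/002,
doi:10.1209/0295-5075/24/7/003: intrinsic 1/N, normal phase). DELTA: (a) N* = (W/Delta)^{1/2} =
e^{1/(2 alpha rho^2 U^2)} of the REPULSIVE model (attraction = Kohn-Luttinger output) as expansion
parameter of the BROKEN phase - known in spirit (CFS Ch.4); (b) NEW COMBINATION, typed here: fixed-N
operator-theoretic implementation on even tori - reduced d-wave BCS torus model T - (g/L^2)Dd^+Dd as
the N = infinity anchor with every-ground-state LRO from a three-line energy identity,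
particle-particle patch bosons with 1/N* remainders (BenedikterNamPortaSchleinSeiringer2021
doi:10.1007/s00222-021-01041-5 bosonizes particle-HOLE pairs for energies;
FalconiGiacomelliHainzlPorta2021 doi:10.1007/s00023-021-01031-6 pp pairs, dilute, energies only),
and the k=0 pair mode as an exact number/phase rotor (Seiringer2011 doi:10.1007/s00220-011-1261-6,
bosons) - replacing the source + SSB=>LRO transfer of route WeakCouplingBCS; plus the one-loop kill
test recorded (Goldstone c  [refs: 10.1209/0295-5075/24/6/002, 10.1209/0295-5075/24/7/003:, 10.1007/s00222-021-01041-5, 10.1007/s00023-021-01031-6, 10.1007/s00220-011-1261-6, 10.1090/s0065-9266-2012-00666-6, cond-mat/9508063, doi:10.1209/0295-5075/24/6/002, doi:10.1209/0295-5075/24/7/003, doi:10.1007/s00222-021-01041-5, doi:10.1007/s00023-021-01031-6, doi:10.1007/s00220-011-1261-6, doi:10.1090/s0065-9266-2012-00666-6, ChenFrohlichS]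

Barriers (technique_class: intrinsic-large-N; pp-patch-bosonization; fixed-N-rotor): technique_class: intrinsic-large-N; pp-patch-bosonization; fixed-N-rotor
Literature.Barriers.HubbardSuperconductivity.WeakCouplingCeiling: APPLIES to reaching the gap scale
from the bare model (Cooper logarithm; convergent expansions proved only for T >= e^{-a/|U|},
BGM2006 at density < 1/4) and is NOT evaded above that scale - the route inherits the
Disertori-Rivasseau/FKT sector analysis down to the scale where the B1g ladder is O(1) (shared
exposure with WeakCouplingBCS crux 4); its new content starts AT that scale, where the expansion
parameter switches from U to 1/N(eps) = (eps/W)^{1/2}, i.e. it is not an expansion around U = 0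
below the ceiling but around the reduced-BCS (N = infinity) member: outside the barrier's technique
class below the ceiling, inside it above.
Literature.Barriers.HubbardSuperconductivity.PerturbativeInvisibilityOfPairing: EVADED structurally
- Delta and N* = e^{1/(2 alpha rho^2 U^2)} are outputs of the N = infinity gap equation (a resummed
bubble chain), never coefficients of a truncated U-series; the barrier's flat function is exactly
1/N*^2; the typed layer asserts no rate in U (also PerturbativeInvisibilityOfPairingNarrow: same).
Literature.Barriers.HubbardSuperconductivity.GeneralizedHartreeFockNoPairing: EVADED - the N =
infinity theory is BCS with the Kohn-Luttinger B1g vertex generated by particle-hole bubbles (crux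
KohnLuttingerB1gPoint), not with bare U; with bare U the N = infinity stationary point is normal,
consistent with BachLiebSolo

History (route lifecycle, newest last):
- 2026-08-15T16:31:32Z · rev 2: restated UniformLROGivesSummitMatrix (stmt-HubbardSuperconductivity-1659), Assembly (stmt-HubbardSuperconductivity-1662) — route-repair rev 2 (cone guardrail + glue.missing + crux-floor, one edit): (1) drop import Literature.Barriers.HubbardSuperconductivity.PureModelStripeCompetiti (planner-rbadge-HubbardSuperconductivity-Intrin-0f86bff1-g2-0)
- 2026-08-15T16:31:32Z · rev 2: dropped OneOverNTransfer — route-repair rev 2 (cone guardrail + glue.missing + crux-floor, one edit): (1) drop import Literature.Barriers.HubbardSuperconductivity.PureModelStripeCompetiti (planner-rbadge-HubbardSuperconductivity-Intrin-0f86bff1-g2-0)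
- 2026-08-16T03:19:25Z · rev 4: dropped OneOverNTransfer — re-apply the rev-2 drop of OneOverNTransfer (stmt-HubbardSuperconductivity-1656): rev 2 (2026-08-15T16:31Z) records dropped:[OneOverNTransfer] — replaced by its (planner-rchoice-HubbardSuperconductivity-Intri-a2899837-0)
- 2026-08-22T19:53:11Z · DORMANT — reconciler: no traction for 5.6 d (last activity item-evidence-added at 2026-08-17T04:34:11Z); parked, not closed — `ledger route dormant route-HubbardSupercond (operator:999:520671)

sub-problem: HubbardSuperconductivity · status: dormant · opened planner-plancard-HubbardSuperconductivity-Hub-49195d05-0 2026-08-15T10:57:50Z · rev 6 · ledger route-HubbardSuperconductivity-IntrinsicLargeN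
GENERATED by the gate from the ledger (D-0016/17). Provers cite these decls: `theorem foo : Summit.HubbardSuperconductivity.HubbardSuperconductivity.Theses.IntrinsicLargeN.<Decl> := …` in Summits/HubbardSuperconductivity/HubbardSuperconductivity/Theorems/<Name>.lean.
-/

namespace Summit.HubbardSuperconductivity.HubbardSuperconductivity.Theses.IntrinsicLargeN

open scoped BigOperators Topology Manifold Classical MeasureTheory ProbabilityTheory Matrix InnerProductSpace ComplexConjugate ContinuousMap
open Filter Set Function TopologicalSpace MeasureTheory

attribute [summit_statement] _root_.HubbardSuperconductivity

open Literature.Hubbard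

/-- item stmt-HubbardSuperconductivity-1655 · target · rank 0 · open · by planner
why it might fail: Weak-coupling d-wave LRO for EVERY (N_L,S^z=0)-sector GS at ALL U in (0,U₀) at one fixed δ is unproved for any 2D short-range lattice fermion model; fails if the B1g window drifts with U, a competing order wins along some U_n→0+, or accidental sector degeneracy breaks every-GS.
sources: RaghuKivelsonScalapino2010 (arXiv:1002.0591 p.7: d_{x2-y2} for 1>n>0.6 at t'=0), ArovasBergKivelsonRaghu2022, ChenFrohlichSeifert1995, FeldmanMagnenRivasseauTrubowitz1993Vector, Literature.Barriers.HubbardSuperconductivity.WeakCouplingCeiling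
[target] Thesis X of route IntrinsicLargeN (card intrinsic-large-n-cooper-pairs): there are U0 > 0
and delta in (0,1/2) such that for EVERY U in (0,U0) some a > 0, L0 give a*L^4 <= Re<psi, Dd^+ Dd
psi> for every even L >= L0 and every normalised (N_L, S^z=0)-sector ground state psi of
hubbardTorus 2 L 1 U (N_L = 2*floor((1-delta)L^2/2), Dd = pairField dWaveFormFactor L). Fixed N, no
source, uniform in L: the canonical-sector form of weak-coupling d-wave superconductivity; => summit
by UniformLROGivesSummitMatrix and U := U0/2. The 1/N* mechanism predicts a(U) = |psi_BCS(U)|^2 (1 +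
O(U) + O(1/N*)) with N* = e^{1/(2 alpha rho^2 U^2)}; no rate is asserted here. -/
@[route_item "route-HubbardSuperconductivity-IntrinsicLargeN"]
def LargeNThesis : Prop :=
  ∃ U₀ : ℝ, 0 < U₀ ∧ ∃ δ ∈ Set.Ioo (0:ℝ) (1/2), ∀ U ∈ Set.Ioo (0:ℝ) U₀, (∃ a : ℝ, 0 < a ∧ ∃ L₀ : ℕ, ∀ (L : ℕ) [NeZero L], L₀ ≤ L → Even L → ∀ ψ : Literature.MathematicalPhysics.QuantumLattice.Fock (Literature.MathematicalPhysics.QuantumLattice.Orb (Literature.MathematicalPhysics.QuantumLattice.FermionTorus 2 L)), star ψ ⬝ᵥ ψ = 1 → Literature.MathematicalPhysics.QuantumLattice.IsGroundStateInSector (Literature.MathematicalPhysics.QuantumLattice.hubbardTorus 2 L 1 U) (2 * ⌊(1 - δ) * (L : ℝ) ^ 2 / 2⌋₊) 0 ψ → a * (L : ℝ) ^ 4 ≤ (Literature.MathematicalPhysics.QuantumLattice.expect ((Literature.MathematicalPhysics.QuantumLattice.pairField Literature.MathematicalPhysics.QuantumLattice.dWaveFormFactor L)ᴴ * Literature.MathematicalPhysics.QuantumLattice.pairField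 Literature.MathematicalPhysics.QuantumLattice.dWaveFormFactor L) ψ).re)

/-- item stmt-HubbardSuperconductivity-10970 · crux · rank 2 · open · by planner
why it might fail: g is only bounded below, so the item ⟺ (φ := sector minimiser of H_red(1), ε := 0, θ := 1−a/B_d²): ∀U<U₀ SOME sector GS has d-wave LRO ≥ aL⁴ on all large even tori — open for every 2D lattice fermion model; fails if a competing order wins along U_n→0+ or the condensate is not uniform in L.
sources: FeldmanMagnenRivasseauTrubowitz1993Vector (doi:10.1209/0295-5075/24/7/003), FeldmanMagnenRivasseauTrubowitz1993Intrinsic (doi:10.1209/0295-5075/24/6/002), ChenFrohlichSeifert1995 (arXiv:cond-mat/9508063 Ch. 4), BenedikterNamPortaSchleinSeiringer2021 (doi:10.1007/s00222-021-01041-5 §5, Lemma 5.2), FalconiGiacomelliHainzlPorta2021 (doi:10.1007/s00023-021-01031-6 §4.1), RaghuKivelsonScalapino2010 (arXiv:1002.0591 §II–III)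
[crux] PAIR-SECTOR SHADOW AT THE KOHN–LUTTINGER SCALE (rev 2: the 1/N* = mean-field-exactness half
of the rev-1 transfer crux OneOverNTransfer). Under certified B1g attraction+dominance at δ there
are κ > 0, U₀ > 0 such that for every U ∈ (0,U₀) there is an effective d-wave coupling g ≥ κU² (the
Kohn–Luttinger scale; g is existential because the prefactor of the gap is renormalised at all
orders — only its ORDER U² is asserted), losses ε < 1, θ < 1 and L₀ with: on every even torus L ≥ L₀
SOME normalised (N_L, S^z=0)-sector ground state ψ₀ of the PURE model hubbardTorus 2 L 1 U has a
SHADOW φ — a unit vector of the same sector — which (i) captures the fraction (1−ε) of the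
condensation energy of the reduced d-wave BCS torus model H_red(g) = T − (g/L²)Δ_d†Δ_d (Re⟨φ,H_red
φ⟩ ≤ minE(H_red) + ε·(minE(T) − minE(H_red)), sector minima; T = hubbardTorus 2 L 1 0) and (ii)
carries at most (1−θ)⁻¹ times the d-wave pair LRO of ψ₀ ((1−θ)·Re⟨φ,Δ_d†Δ_dφ⟩ ≤ Re⟨ψ₀,Δ_d†Δ_dψ₀⟩).
Intended proof (card steps ii–iv): φ = W*ψ₀ with W the number- and spin-conserving particle–HOLE
correlation dressing of the weakly interacting Fermi liquid (patch bosonisation à la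
BenedikterNamPortaSchleinSeiringer2021; pp -/
@[route_item "route-HubbardSuperconductivity-IntrinsicLargeN", crux]
def PairSectorShadow : Prop :=
  ∀ δ ∈ Set.Ioo (0:ℝ) (1/2), ∀ γ U₁ : ℝ, 0 < γ → 0 < U₁ → (∀ U ∈ Set.Ioo (0:ℝ) U₁, Literature.MathematicalPhysics.QuantumLattice.channelInf (Literature.MathematicalPhysics.QuantumLattice.squareDispersion 1 0) (Literature.MathematicalPhysics.QuantumLattice.chemicalPotentialOfDensity (Literature.MathematicalPhysics.QuantumLattice.squareDispersion 1 0) (1 - δ)) U Literature.MathematicalPhysics.QuantumLattice.D4Irrep.B1g ≤ -(γ * U ^ 2) ∧ ∀ χ : Literature.MathematicalPhysics.QuantumLattice.D4Irrep, χ ≠ Literature.MathematicalPhysics.QuantumLattice.D4Irrep.B1g → Literature.MathematicalPhysics.QuantumLattice.channelInf (Literature.MathematicalPhysics.QuantumLattice.squareDispersion 1 0) (Literature.MathematicalPhysics.QuantumLattice.chemicalPotentialOfDensity (Literature.MathematicalPhysics.QuantumLattice.squareDispersion 1 0) (1 - δ)) U Literature.MathematicalPhysics.QuantumLattice.D4Irrep.B1g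 + γ * U ^ 2 ≤ Literature.MathematicalPhysics.QuantumLattice.channelInf (Literature.MathematicalPhysics.QuantumLattice.squareDispersion 1 0) (Literature.MathematicalPhysics.QuantumLattice.chemicalPotentialOfDensity (Literature.MathematicalPhysics.QuantumLattice.squareDispersion 1 0) (1 - δ)) U χ) → ∃ κ : ℝ, 0 < κ ∧ ∃ U₀ : ℝ, 0 < U₀ ∧ ∀ U ∈ Set.Ioo (0:ℝ) U₀, ∃ g : ℝ, κ * U ^ 2 ≤ g ∧ ∃ ε θ : ℝ, ε < 1 ∧ θ < 1 ∧ ∃ L₀ : ℕ, ∀ (L : ℕ) [NeZero L], L₀ ≤ L → Even L → let D := ((Literature.MathematicalPhysics.QuantumLattice.pairField Literature.MathematicalPhysics.QuantumLattice.dWaveFormFactor L)ᴴ * Literature.MathematicalPhysics.QuantumLattice.pairField Literature.MathematicalPhysics.QuantumLattice.dWaveFormFactor L); let H := Literature.MathematicalPhysics.QuantumLattice.hubbardTorus 2 L 1 0 - ((g / (L : ℝ) ^ 2 : ℝ) : ℂ) • D; let S := Literature.MathematicalPhysics.QuantumLattice.szSector (2 * ⌊(1 - δ) * (L : ℝ)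 ^ 2 / 2⌋₊) 0; ∃ ψ₀ : Literature.MathematicalPhysics.QuantumLattice.Fock (Literature.MathematicalPhysics.QuantumLattice.Orb (Literature.MathematicalPhysics.QuantumLattice.FermionTorus 2 L)), star ψ₀ ⬝ᵥ ψ₀ = 1 ∧ Literature.MathematicalPhysics.QuantumLattice.IsGroundStateInSector (Literature.MathematicalPhysics.QuantumLattice.hubbardTorus 2 L 1 U) (2 * ⌊(1 - δ) * (L : ℝ) ^ 2 / 2⌋₊) 0 ψ₀ ∧ ∃ φ : Literature.MathematicalPhysics.QuantumLattice.Fock (Literature.MathematicalPhysics.QuantumLattice.Orb (Literature.MathematicalPhysics.QuantumLattice.FermionTorus 2 L)), φ ∈ S ∧ star φ ⬝ᵥ φ = 1 ∧ (Literature.MathematicalPhysics.QuantumLattice.expect H φ).re ≤ H.minEnergyOn S + ε * ((Literature.MathematicalPhysics.QuantumLattice.hubbardTorus 2 L 1 0).minEnergyOn S - H.minEnergyOn S) ∧ (1 - θ) * (Literature.MathematicalPhysics.QuantumLattice.expect D φ).re ≤ (Literature.MathematicalPhysics.QuantumLattice.expect D ψ₀).re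

/-- item stmt-HubbardSuperconductivity-10971 · crux · rank 3 · open · by planner
why it might fail: Automatic (Schur) on a symmetry-irreducible ground multiplet (Δ_d†Δ_d is translation/D4/spin invariant); fails by ACCIDENTAL sector-GS degeneracy with macroscopically different pair order at one U on infinitely many even L — U-crossings and nontrivial GS irreps occur on 4×4 tori; open at weak U.
sources: KomaTasaki1994 (arXiv:cond-mat/9708132 §0.7, Thm 2.3), Tasaki2019Tower (arXiv:1807.05847 §3.2), Seiringer2011 (doi:10.1007/s00220-011-1261-6), VonDelftRalph2001 (§4.2–5.1: parity and shell effects at fixed N), RaghuKivelsonScalapino2010 (arXiv:1002.0591 Fig. 2: B1g/B2g crossing near n ≈ 0.6), FanoOrtolaniParola1992 (doi:10.1103/physrevb.46.1048: group-theoretical + numerical classification of 4×4 Hubbard ground states, GS irreps and crossings vs filling/U)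
[crux] GROUND-EIGENSPACE HOMOGENEITY OF THE d-WAVE ORDER (rev 2: the exact-rotor /
every-ground-state half of the rev-1 transfer crux OneOverNTransfer). Under certified B1g dominance
at δ: ∃U₀ ∀U ∈ (0,U₀) ∃θ < 1 ∃L₀ such that on every even torus L ≥ L₀ ANY two normalised (N_L,
S^z=0)-sector ground states ψ, ψ′ of hubbardTorus 2 L 1 U satisfy Re⟨ψ,Δ_d†Δ_dψ⟩ ≥
(1−θ)·Re⟨ψ′,Δ_d†Δ_dψ′⟩ — the d-wave pair LRO is comparable across the (possibly degenerate) ground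
eigenspace. Mechanism: at fixed N the k = 0 pair mode is an exact number/phase rotor (Anderson
tower; Seiringer2011-type zero-mode extraction; KomaTasaki1994 tower); all sector ground states
share ONE condensate and differ only in nodal-quasiparticle / open-shell quantum numbers, which
change ⟨Δ_d†Δ_d⟩ by O(L³) ≪ L⁴; momentum ±K partners have equal LRO by inversion and zero cross
terms (Δ_d†Δ_d carries momentum 0), so superpositions inside such multiplets are harmless. This
isolates the every-ground-state risk of the summit (first-order coexistence / level crossings inside
the ground eigenspace) from the existence of the condensate (PairSectorShadow). Trivial where the
sector ground state is unique; the content sits at exact degen -/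
@[route_item "route-HubbardSuperconductivity-IntrinsicLargeN", crux]
def GroundEigenspaceHomogeneity : Prop :=
  ∀ δ ∈ Set.Ioo (0:ℝ) (1/2), ∀ γ U₁ : ℝ, 0 < γ → 0 < U₁ → (∀ U ∈ Set.Ioo (0:ℝ) U₁, Literature.MathematicalPhysics.QuantumLattice.channelInf (Literature.MathematicalPhysics.QuantumLattice.squareDispersion 1 0) (Literature.MathematicalPhysics.QuantumLattice.chemicalPotentialOfDensity (Literature.MathematicalPhysics.QuantumLattice.squareDispersion 1 0) (1 - δ)) U Literature.MathematicalPhysics.QuantumLattice.D4Irrep.B1g ≤ -(γ * U ^ 2) ∧ ∀ χ : Literature.MathematicalPhysics.QuantumLattice.D4Irrep, χ ≠ Literature.MathematicalPhysics.QuantumLattice.D4Irrep.B1g → Literature.MathematicalPhysics.QuantumLattice.channelInf (Literature.MathematicalPhysics.QuantumLattice.squareDispersion 1 0) (Literature.MathematicalPhysics.QuantumLattice.chemicalPotentialOfDensity (Literature.MathematicalPhysics.QuantumLattice.squareDispersion 1 0) (1 - δ)) U Literature.MathematicalPhysics.QuantumLattice.D4Irrep.B1g + γ * U ^ 2 ≤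 Literature.MathematicalPhysics.QuantumLattice.channelInf (Literature.MathematicalPhysics.QuantumLattice.squareDispersion 1 0) (Literature.MathematicalPhysics.QuantumLattice.chemicalPotentialOfDensity (Literature.MathematicalPhysics.QuantumLattice.squareDispersion 1 0) (1 - δ)) U χ) → ∃ U₀ : ℝ, 0 < U₀ ∧ ∀ U ∈ Set.Ioo (0:ℝ) U₀, ∃ θ : ℝ, θ < 1 ∧ ∃ L₀ : ℕ, ∀ (L : ℕ) [NeZero L], L₀ ≤ L → Even L → ∀ ψ ψ' : Literature.MathematicalPhysics.QuantumLattice.Fock (Literature.MathematicalPhysics.QuantumLattice.Orb (Literature.MathematicalPhysics.QuantumLattice.FermionTorus 2 L)), star ψ ⬝ᵥ ψ = 1 → star ψ' ⬝ᵥ ψ' = 1 → Literature.MathematicalPhysics.QuantumLattice.IsGroundStateInSector (Literature.MathematicalPhysics.QuantumLattice.hubbardTorus 2 L 1 U) (2 * ⌊(1 - δ) * (L : ℝ) ^ 2 / 2⌋₊) 0 ψ → Literature.MathematicalPhysics.QuantumLattice.IsGroundStateInSector (Literature.MathematicalPhysics.QuantumLattice.hubbardTorus 2 L 1 U) (2 *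 ⌊(1 - δ) * (L : ℝ) ^ 2 / 2⌋₊) 0 ψ' → (1 - θ) * (Literature.MathematicalPhysics.QuantumLattice.expect ((Literature.MathematicalPhysics.QuantumLattice.pairField Literature.MathematicalPhysics.QuantumLattice.dWaveFormFactor L)ᴴ * Literature.MathematicalPhysics.QuantumLattice.pairField Literature.MathematicalPhysics.QuantumLattice.dWaveFormFactor L) ψ').re ≤ (Literature.MathematicalPhysics.QuantumLattice.expect ((Literature.MathematicalPhysics.QuantumLattice.pairField Literature.MathematicalPhysics.QuantumLattice.dWaveFormFactor L)ᴴ * Literature.MathematicalPhysics.QuantumLattice.pairField Literature.MathematicalPhysics.QuantumLattice.dWaveFormFactor L) ψ).re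

/-- item stmt-HubbardSuperconductivity-1657 · support · rank 3 · closed · proved by Summit.HubbardSuperconductivity.HubbardSuperconductivity.Theorems.IntrinsicLargeN.reducedBCSAnchor_proof @ ac35b96f041e (prover) · by planner
why it might fail: Needs a number-projected d-wave BCS trial state beating the free Fermi sea by c*L^2 UNIFORMLY in even L at fixed g (shell/parity effects, VonDelftRalph2001; nodes of w; c ~ Delta_g^2 ~ e^{-2/(rho g)}); no T=0 fixed-N approximating-Hamiltonian theorem is printed (BruPedra2013: T>0).
sources: HainzlHamzaSeiringerSolovej2008, BachLiebSolovej1994, Bogolubov1966, VonDelftRalph2001, Richardson1963, RomanSierraDukelsky2002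
[crux] The N = infinity member at fixed particle number. For every g > 0 and delta in (0,1), the
reduced d-wave BCS torus model H_red = hubbardTorus 2 L 1 0 - (g/L^2) Dd^+ Dd (free n.n. hopping
plus the separable, number- and spin-conserving d-wave pair attraction built from the summit's own
pair field; Fourier form -(g/L^2) Sum_{k,k'} w(k)w(k') b_k^+ b_k', w(k) = 2(cos k1 - cos k2)) has
EXTENSIVE condensation energy in the summit's sector: minE over szSector N_L 0 of the free hopping
exceeds that of H_red by >= c L^2 for even L >= L0(g,delta). Provable route: upper bound on
minE(H_red) by a number-projected (S^z = 0, N_L-particle) d-wave BCS trial state and the lattice gap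
equation 1 = (g/L^2) Sum_k w(k)^2/(2E_k) (Cooper logarithm: a solution Delta_g > 0 exists for every
g > 0 since w does not vanish identically on the Fermi curve and the density of states is positive
for delta in (0,1)); c ~ rho_w Delta_g^2. Consequence (support ReducedBCSEnergyGivesLRO, three
lines): EVERY sector ground state of H_red has <Dd^+Dd> >= (c/g) L^4 - every-GS, source-free d-wave
LRO for the solvable member, the base point of the 1/N* expansion (Richardson1963 exactness /
BruPedra2013 approximating-Ha -/
@[route_item "route-HubbardSuperconductivity-IntrinsicLargeN", crux]
def ReducedBCSAnchor : Prop :=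
  ∀ g : ℝ, 0 < g → ∀ δ ∈ Set.Ioo (0:ℝ) 1, (∃ c : ℝ, 0 < c ∧ ∃ L₀ : ℕ, ∀ (L : ℕ) [NeZero L], L₀ ≤ L → Even L → (Literature.MathematicalPhysics.QuantumLattice.hubbardTorus 2 L 1 0 - ((g / (L : ℝ) ^ 2 : ℝ) : ℂ) • ((Literature.MathematicalPhysics.QuantumLattice.pairField Literature.MathematicalPhysics.QuantumLattice.dWaveFormFactor L)ᴴ * Literature.MathematicalPhysics.QuantumLattice.pairField Literature.MathematicalPhysics.QuantumLattice.dWaveFormFactor L)).minEnergyOn (Literature.MathematicalPhysics.QuantumLattice.szSector (2 * ⌊(1 - δ) * (L : ℝ) ^ 2 / 2⌋₊) 0) + c * (L : ℝ) ^ 2 ≤ (Literature.MathematicalPhysics.QuantumLattice.hubbardTorus 2 L 1 0).minEnergyOn (Literature.MathematicalPhysics.QuantumLattice.szSector (2 * ⌊(1 - δ) * (L : ℝ) ^ 2 / 2⌋₊) 0))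

/-- item stmt-HubbardSuperconductivity-1658 · support · rank 4 · open · by planner
why it might fail: RKS Fig.2 (non-rigorous) has d_{x2-y2} leading only for 0.6<n<1; extended-s (A1g, zero Fermi-curve mean) is NOT penalised by bare U and competes at O(U^2); no margin near the B1g/B2g crossing; sInf/Bochner junk values of channelInf, fermiCurveMeasure, chemicalPotentialOfDensity may bite.
sources: RaghuKivelsonScalapino2010 (arXiv:1002.0591 p.7 Fig. tprime0: d_{x2-y2} ground state for 1>n>0.6 at t'=0; chi(Q) ~ ln^2 enhancement near half filling), Hlubina1999, SimkovicEtAl2016, DengEtAl2015, KohnLuttinger1965, Literature.MathematicalPhysics.QuantumLattice.channelInf (KohnLuttinger.lean: sInf over IsChannelState; chemicalPotentialOfDensity sInf; fermiCurveMeasure = muH[1]|F withDensity 1/|grad eps|)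
[crux] N = infinity input data (certified computation). For the t=1, t'=0 band squareDispersion 1 0
at density 1 - delta there is SOME delta in (0,1/2) and gamma, U1 > 0 such that for all U in (0,U1):
channelInf(B1g) <= -gamma U^2 (the d_{x^2-y^2} channel of the Kohn-Luttinger kernel U + U^2
chi(k+k') on the Fermi curve is attractive at second order) and channelInf(B1g) + gamma U^2 <=
channelInf(chi) for every other D4 channel chi (strict dominance with a U^2 margin). Since the bare
U acts only on A1g and the U^2 scales out elsewhere, this is a U-independent comparison of
second-order eigenvalues on ONE Fermi curve: deliverable = interval-arithmetic certificate at a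
single delta (e.g. delta = 1/4 or 1/8; RaghuKivelsonScalapino2010 Fig. 2 report d_{x^2-y^2} leading
for 0.6 < n < 1 at t'=0, non-rigorously). Pointwise-in-delta variant of
stmt-HubbardSuperconductivity-0158 (route WeakCouplingBCS), pinned inside the summit's doping range
(0,1/2) so that the assembly is pure logic (0158 has b < 1; see
Theorems/WeakCouplingBCSWcbcsThesis.lean on the doping-range gap). A certificate for 0158 with a <
1/2 proves this item too. -/
@[route_item "route-HubbardSuperconductivity-IntrinsicLargeN", crux]
def KohnLuttingerB1gPoint : Prop :=
  ∃ δ ∈ Set.Ioo (0:ℝ) (1/2), ∃ γ U₁ : ℝ, 0 < γ ∧ 0 < U₁ ∧ (∀ U ∈ Set.Ioo (0:ℝ) U₁, Literature.MathematicalPhysics.QuantumLattice.channelInf (Literature.MathematicalPhysics.QuantumLattice.squareDispersion 1 0) (Literature.MathematicalPhysics.QuantumLattice.chemicalPotentialOfDensity (Literature.MathematicalPhysics.QuantumLattice.squareDispersion 1 0) (1 - δ)) U Literature.MathematicalPhysics.QuantumLattice.D4Irrep.B1g ≤ -(γ * U ^ 2) ∧ ∀ χ : Literature.MathematicalPhysics.QuantumLattice.D4Irrep,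 χ ≠ Literature.MathematicalPhysics.QuantumLattice.D4Irrep.B1g → Literature.MathematicalPhysics.QuantumLattice.channelInf (Literature.MathematicalPhysics.QuantumLattice.squareDispersion 1 0) (Literature.MathematicalPhysics.QuantumLattice.chemicalPotentialOfDensity (Literature.MathematicalPhysics.QuantumLattice.squareDispersion 1 0) (1 - δ)) U Literature.MathematicalPhysics.QuantumLattice.D4Irrep.B1g + γ * U ^ 2 ≤ Literature.MathematicalPhysics.QuantumLattice.channelInf (Literature.MathematicalPhysics.QuantumLattice.squareDispersion 1 0) (Literature.MathematicalPhysics.QuantumLattice.chemicalPotentialOfDensity (Literature.MathematicalPhysics.QuantumLattice.squareDispersion 1 0) (1 - δ)) U χ)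

-- earlier UniformLROGivesSummitMatrix (stmt-HubbardSuperconductivity-1659, replaced 2026-08-15T16:31:32Z -> stmt-HubbardSuperconductivity-10968): retired by None — ∀ U δ : ℝ, (∃ a : ℝ, 0 < a ∧ ∃ L₀ : ℕ, ∀ (L : ℕ) [NeZero L], L₀ ≤ L → Even L → ∀ ψ : Literature.MathematicalPhysics.QuantumLattice.Fock (Literature.MathematicalPhysics.QuantumLattice.Orb (Literature.MathematicalPhysics.QuantumLattice.Ferm
/-- item stmt-HubbardSuperconductivity-10968 · support · rank 9 · closed · proved by Summit.HubbardSuperconductivity.HubbardSuperconductivity.Theorems.IntrinsicLargeN.uniformLROGivesSummitMatrix_proof (prover) · by planner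
sources: Scalapino1995, Literature.Barriers.HubbardSuperconductivity.HasDWavePairFieldLROAt
[support] Glue, provable now (restated rev 2: the summit's matrix is inlined verbatim, so the route
no longer imports Literature.Barriers.HubbardSuperconductivity.PureModelStripeCompetition and its
two unproved numerical claims leave the cone; Iff.rfl with the rev-1 conclusion
HasDWavePairFieldLROAt U δ). A uniform finite-L lower bound a·L⁴ ≤ Re⟨ψ, Δ_d†Δ_d ψ⟩ for every
normalised (N_L,0)-sector ground state on even tori L ≥ L₀ implies that every even-side-admissible
sequence (N, ψ) has HasLongRangeOrder of torusPullback (pairFieldCorr dWaveFormFactor ψ) (2k) over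
halfOpenBox 2 (2k) — word for word the body of HubbardSuperconductivity at (U, δ). Proof pattern
(Theorems/WeakCouplingBCSWcbcsThesis.lean): sum_pairFieldCorr_succ /
expect_pairField_conjTranspose_mul (Σ_{x,y}⟨P_x†P_y⟩ = ⟨Δ_d†Δ_d⟩), the a-priori bound
lroSeq_pairFieldCorr_le to keep Mathlib's real liminf honest, and the liminf along L = 2k
(hasTorusLRO_of_eventually_le / liminf_comp_pos_of_le; NeZero (2k) for k ≥ 1). -/
@[route_item "route-HubbardSuperconductivity-IntrinsicLargeN", crux]
def UniformLROGivesSummitMatrix : Prop :=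
  ∀ U δ : ℝ, (∃ a : ℝ, 0 < a ∧ ∃ L₀ : ℕ, ∀ (L : ℕ) [NeZero L], L₀ ≤ L → Even L → ∀ ψ : Literature.MathematicalPhysics.QuantumLattice.Fock (Literature.MathematicalPhysics.QuantumLattice.Orb (Literature.MathematicalPhysics.QuantumLattice.FermionTorus 2 L)), star ψ ⬝ᵥ ψ = 1 → Literature.MathematicalPhysics.QuantumLattice.IsGroundStateInSector (Literature.MathematicalPhysics.QuantumLattice.hubbardTorus 2 L 1 U) (2 * ⌊(1 - δ) * (L : ℝ) ^ 2 / 2⌋₊) 0 ψ → a * (L : ℝ) ^ 4 ≤ (Literature.MathematicalPhysics.QuantumLattice.expect ((Literature.MathematicalPhysics.QuantumLattice.pairField Literature.MathematicalPhysics.QuantumLattice.dWaveFormFactor L)ᴴ * Literature.MathematicalPhysics.QuantumLattice.pairField Literature.MathematicalPhysics.QuantumLattice.dWaveFormFactor L) ψ).re) → ∀ (N : ℕ → ℕ) (ψ : ∀ L, Literature.MathematicalPhysics.QuantumLattice.Fock (Literature.MathematicalPhysics.QuantumLattice.Orb (Literature.MathematicalPhysics.QuantumLattice.FermionTorus 2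 L))), (∀ L, Even L → N L = 2 * ⌊(1 - δ) * (L : ℝ) ^ 2 / 2⌋₊ ∧ star (ψ L) ⬝ᵥ ψ L = 1 ∧ Literature.MathematicalPhysics.QuantumLattice.IsGroundStateInSector (Literature.MathematicalPhysics.QuantumLattice.hubbardTorus 2 L 1 U) (N L) 0 (ψ L)) → Literature.Probability.LatticeModels.HasLongRangeOrder (fun k => Literature.Probability.LatticeModels.halfOpenBox 2 (2 * k)) (fun k => Literature.MathematicalPhysics.QuantumLattice.torusPullback (Literature.MathematicalPhysics.QuantumLattice.pairFieldCorr Literature.MathematicalPhysics.QuantumLattice.dWaveFormFactor ψ) (2 * k))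

/-- item stmt-HubbardSuperconductivity-10972 · support · rank 9 · closed · proved by Summit.HubbardSuperconductivity.HubbardSuperconductivity.Theorems.IntrinsicLargeN.shadowCondensation_proof (prover) · by planner
sources: Literature.MathematicalPhysics.QuantumLattice.sector_groundState (SectorSpectrum.lean), Richardson1963, Literature.MathematicalPhysics.QuantumLattice.IsGroundStateInSector
[support] Provable now (generalises ReducedBCSEnergyGivesLRO from ground states to near-ground
states; the analytic step of the deciding theorem). For H_red = T − (g/L²)Δ_d†Δ_d (T = hubbardTorus
2 L 1 0), g > 0, any N, c, ε ≤ 1 and any unit φ ∈ szSector N 0: if minE(H_red) + c ≤ minE(T) on the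
sector and Re⟨φ,H_red φ⟩ ≤ minE(H_red) + ε·(minE(T) − minE(H_red)), then Re⟨φ,Δ_d†Δ_dφ⟩ ≥
(1−ε)·L²c/g. Proof (three lines): (g/L²)·Re⟨φ,Δ_d†Δ_dφ⟩ = Re⟨φ,Tφ⟩ − Re⟨φ,H_red φ⟩ ≥ minE(T) −
minE(H_red) − ε·(minE(T) − minE(H_red)) ≥ (1−ε)·c, using only the variational bound minE_sector(T) ≤
Re⟨φ,Tφ⟩ for a unit vector of the sector (SectorSpectrum.sector_groundState pattern, or BddBelow of
the Rayleigh set as in HubbardModelThermodynamicLimitProofs) and linearity of expect (mulVec_sub,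
smul). [deps: none] [difficulty: provable-now] -/
@[route_item "route-HubbardSuperconductivity-IntrinsicLargeN", crux]
def ShadowCondensation : Prop :=
  ∀ g : ℝ, 0 < g → ∀ (L : ℕ) [NeZero L] (N : ℕ) (c ε : ℝ) (φ : Literature.MathematicalPhysics.QuantumLattice.Fock (Literature.MathematicalPhysics.QuantumLattice.Orb (Literature.MathematicalPhysics.QuantumLattice.FermionTorus 2 L))), ε ≤ 1 → star φ ⬝ᵥ φ = 1 → φ ∈ (Literature.MathematicalPhysics.QuantumLattice.szSector N 0) → (Literature.MathematicalPhysics.QuantumLattice.hubbardTorus 2 L 1 0 - ((g / (L : ℝ) ^ 2 : ℝ) : ℂ) • ((Literature.MathematicalPhysics.QuantumLattice.pairField Literature.MathematicalPhysics.QuantumLattice.dWaveFormFactor L)ᴴ * Literature.MathematicalPhysics.QuantumLattice.pairField Literature.MathematicalPhysics.QuantumLattice.dWaveFormFactor L)).minEnergyOn (Literature.MathematicalPhysics.QuantumLattice.szSector N 0) + c ≤ (Literature.MathematicalPhysics.QuantumLattice.hubbardTorus 2 L 1 0).minEnergyOn (Literature.MathematicalPhysics.QuantumLattice.szSector N 0)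 → (Literature.MathematicalPhysics.QuantumLattice.expect (Literature.MathematicalPhysics.QuantumLattice.hubbardTorus 2 L 1 0 - ((g / (L : ℝ) ^ 2 : ℝ) : ℂ) • ((Literature.MathematicalPhysics.QuantumLattice.pairField Literature.MathematicalPhysics.QuantumLattice.dWaveFormFactor L)ᴴ * Literature.MathematicalPhysics.QuantumLattice.pairField Literature.MathematicalPhysics.QuantumLattice.dWaveFormFactor L)) φ).re ≤ (Literature.MathematicalPhysics.QuantumLattice.hubbardTorus 2 L 1 0 - ((g / (L : ℝ) ^ 2 : ℝ) : ℂ) • ((Literature.MathematicalPhysics.QuantumLattice.pairField Literature.MathematicalPhysics.QuantumLattice.dWaveFormFactor L)ᴴ * Literature.MathematicalPhysics.QuantumLattice.pairField Literature.MathematicalPhysics.QuantumLattice.dWaveFormFactor L)).minEnergyOn (Literature.MathematicalPhysics.QuantumLattice.szSector N 0) + ε * ((Literature.MathematicalPhysics.QuantumLattice.hubbardTorus 2 L 1 0).minEnergyOn (Literature.MathematicalPhysics.QuantumLattice.szSector N 0) - (Literature.MathematicalPhysics.QuantumLattice.hubbardTorus 2 L 1 0 - ((g / (L : ℝ) ^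 2 : ℝ) : ℂ) • ((Literature.MathematicalPhysics.QuantumLattice.pairField Literature.MathematicalPhysics.QuantumLattice.dWaveFormFactor L)ᴴ * Literature.MathematicalPhysics.QuantumLattice.pairField Literature.MathematicalPhysics.QuantumLattice.dWaveFormFactor L)).minEnergyOn (Literature.MathematicalPhysics.QuantumLattice.szSector N 0)) → (1 - ε) * ((L : ℝ) ^ 2 * c / g) ≤ (Literature.MathematicalPhysics.QuantumLattice.expect ((Literature.MathematicalPhysics.QuantumLattice.pairField Literature.MathematicalPhysics.QuantumLattice.dWaveFormFactor L)ᴴ * Literature.MathematicalPhysics.QuantumLattice.pairField Literature.MathematicalPhysics.QuantumLattice.dWaveFormFactor L) φ).re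

/-- item stmt-HubbardSuperconductivity-14241 · support · rank 9 · closed · proved by Summit.HubbardSuperconductivity.HubbardSuperconductivity.Theorems.IntrinsicLargeN.largeNThesisOfCruxes_proof (prover) · by planner
sources: Scalapino1995, ChenFrohlichSeifert1995 (arXiv:cond-mat/9508063 Ch. 4)
[support] Glue to the rank-0 target, provable now (rev 3; gate shape route.target-unreachable: an
item must conclude LargeNThesis). The certified Kohn–Luttinger B1g point, the reduced-BCS anchor,
the cruxes PairSectorShadow and GroundEigenspaceHomogeneity and the identity ShadowCondensation
conclude X = LargeNThesis: take δ, γ, U₁ from KohnLuttingerB1gPoint; κ, U₀ˢ from PairSectorShadow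
and U₀ʰ from GroundEigenspaceHomogeneity at that δ; U₀ := min(U₀ˢ, U₀ʰ); for EVERY U ∈ (0, U₀) (not
only the midpoint used by `closes`): g ≥ κU² > 0, ε, θ, L₁ from the shadow, θ′, L₂ from homogeneity,
c, L₃ from the anchor at (g, δ) (δ < 1/2 < 1), a := (1−θ′)(1−θ)(1−ε)·c/g > 0, L₀ := max(L₁, L₂, L₃);
for a sector ground state ψ, ShadowCondensation (with c·L²) bounds the shadow's d-wave LRO below by
(1−ε)L²(cL²)/g, clause (ii) of the shadow transfers it to ψ₀, homogeneity to ψ. Proved sorry-free in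
the planner's Sketch.lean (largeNThesisOfCruxes_holds; axioms propext, Classical.choice, Quot.sound;
attached as route evidence); the deciding theorem closes = SummitOfLargeNThesis ∘
LargeNThesisOfCruxes is unchanged. [deps: KohnLuttingerB1gPoint, ReducedBCSAnchor, PairSectorShadow,
GroundEigenspaceHomogen -/
@[route_item "route-HubbardSuperconductivity-IntrinsicLargeN"]
def LargeNThesisOfCruxes : Prop :=
  KohnLuttingerB1gPoint → ReducedBCSAnchor → PairSectorShadow → GroundEigenspaceHomogeneity → ShadowCondensation → LargeNThesis

/-- item stmt-HubbardSuperconductivity-14242 · support · rank 9 · closed · proved by Summit.HubbardSuperconductivity.HubbardSuperconductivity.Theorems.IntrinsicLargeN.summitOfLargeNThesis_proof (prover) · by planner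
sources: Scalapino1995, ArovasBergKivelsonRaghu2022
[support] Frame statement X → summit, provable now in three lines (rev 3): from LargeNThesis take U₀
> 0 and δ ∈ (0,1/2); put U := U₀/2 ∈ (0, U₀); the uniform every-ground-state bound at (U, δ) is
exactly the hypothesis of UniformLROGivesSummitMatrix at (U, δ), whose conclusion is word for word
the matrix of HubbardSuperconductivity (`unfold HubbardSuperconductivity
Literature.Hubbard.DWaveSuperconductivityHubbard; exact ⟨U₀/2, _, δ, hδ, hG (U₀/2) δ (h (U₀/2)
hU)⟩`). Proved sorry-free in the planner's Sketch.lean (summitOfLargeNThesis_holds). Records inside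
the route that the thesis X decides the summit modulo the bookkeeping support; closes is the
composition SummitOfLargeNThesis ∘ LargeNThesisOfCruxes (an `example` in the sketch) and is
unchanged. [deps: LargeNThesis, UniformLROGivesSummitMatrix] [difficulty: provable-now] -/
@[route_item "route-HubbardSuperconductivity-IntrinsicLargeN"]
def SummitOfLargeNThesis : Prop :=
  LargeNThesis → UniformLROGivesSummitMatrix → HubbardSuperconductivity

/-- item stmt-HubbardSuperconductivity-1660 · support · rank 9 · closed · proved by Summit.HubbardSuperconductivity.HubbardSuperconductivity.Theorems.IntrinsicLargeN.reducedBCSEnergyGivesLRO_proof @ e3a5927e13fd (prover) · by planner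
sources: Richardson1963, Literature.MathematicalPhysics.QuantumLattice.IsGroundStateInSector
[support] Three-line identity, provable now: for H_red = T - (g/L^2) Dd^+Dd (T = hubbardTorus 2 L 1
0) and a normalised ground state psi of H_red in szSector N 0 with minE(H_red) + c <= minE(T) on
that sector: E0 = Re<psi,H_red psi> = Re<psi,T psi> - (g/L^2) Re<psi,Dd^+Dd psi> >= minE(T) -
(g/L^2) X >= E0 + c - (g/L^2) X, hence X = Re<psi, Dd^+Dd psi> >= L^2 c / g. With c = c' L^2 from
ReducedBCSAnchor this is every-ground-state d-wave LRO >= (c'/g) L^4 for the N = infinity member.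
Uses only the sInf definition of Matrix.minEnergyOn (Re<psi,T psi> >= minE(T) for unit psi in the
sector) and IsGroundStateInSector. -/
@[route_item "route-HubbardSuperconductivity-IntrinsicLargeN"]
def ReducedBCSEnergyGivesLRO : Prop :=
  ∀ g : ℝ, 0 < g → ∀ (L : ℕ) [NeZero L] (N : ℕ) (c : ℝ) (ψ : Literature.MathematicalPhysics.QuantumLattice.Fock (Literature.MathematicalPhysics.QuantumLattice.Orb (Literature.MathematicalPhysics.QuantumLattice.FermionTorus 2 L))), star ψ ⬝ᵥ ψ = 1 → Literature.MathematicalPhysics.QuantumLattice.IsGroundStateInSector (Literature.MathematicalPhysics.QuantumLattice.hubbardTorus 2 L 1 0 - ((g / (L : ℝ) ^ 2 : ℝ) : ℂ) • ((Literature.MathematicalPhysics.QuantumLattice.pairField Literature.MathematicalPhysics.QuantumLattice.dWaveFormFactor L)ᴴ * Literature.MathematicalPhysics.QuantumLattice.pairField Literature.MathematicalPhysics.QuantumLattice.dWaveFormFactor L)) N 0 ψ → (Literature.MathematicalPhysics.QuantumLattice.hubbardTorus 2 L 1 0 - ((g / (L : ℝ) ^ 2 : ℝ) : ℂ) • ((Literature.MathematicalPhysics.QuantumLattice.pairField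 Literature.MathematicalPhysics.QuantumLattice.dWaveFormFactor L)ᴴ * Literature.MathematicalPhysics.QuantumLattice.pairField Literature.MathematicalPhysics.QuantumLattice.dWaveFormFactor L)).minEnergyOn (Literature.MathematicalPhysics.QuantumLattice.szSector N 0) + c ≤ (Literature.MathematicalPhysics.QuantumLattice.hubbardTorus 2 L 1 0).minEnergyOn (Literature.MathematicalPhysics.QuantumLattice.szSector N 0) → (L : ℝ) ^ 2 * c / g ≤ (Literature.MathematicalPhysics.QuantumLattice.expect ((Literature.MathematicalPhysics.QuantumLattice.pairField Literature.MathematicalPhysics.QuantumLattice.dWaveFormFactor L)ᴴ * Literature.MathematicalPhysics.QuantumLattice.pairField Literature.MathematicalPhysics.QuantumLattice.dWaveFormFactor L) ψ).re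

/-- item stmt-HubbardSuperconductivity-1661 · support · rank 9 · open · by planner
sources: KomaTasaki1994, Tasaki2019Tower, Seiringer2011, Literature.Barriers.HubbardSuperconductivity.LROForcesLowLyingStates
[support] Typed signature of the EXACT ROTOR (Anderson tower) at weak coupling - a prediction of the
mechanism and a refutation handle, NOT load-bearing for the Assembly. Under certified B1g dominance
at delta there is U0 such that for U in (0,U0) and every eta > 0, for even L >= L0(U,eta) and every
normalised (N_L,0)-sector ground state psi: Re<Dd psi, H Dd psi> <= (minE_H(szSector (N_L - 2) 0) +
eta) * ||Dd psi||^2, H = hubbardTorus 2 L 1 U - i.e. removing a d-wave pair from ANY ground state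
lands, up to TOTAL energy eta -> 0, at the bottom of the adjacent sector (coherent part ~ a L^4 at
E0(N_L - 2) + O(1/L^2); incoherent part has norm^2 O(L^2) at energies O(W), so the excess is O(W/(a
L^2))). Koma-Tasaki Thm 2.3 gives only O(1) for U(1) alone; in a normal (non-superconducting) state
the statement is false (||Dd psi||^2 = O(L^2), excess O(W)), so it morally detects the condensate.
The sharper 'adjacent-sector GROUND-STATE overlap >= a L^4' was rejected: on finite tori the (N_L -
2) ground state may differ from Dd psi by its nodal-level occupation (orthogonal), while staying
O(1/L^2) close in energy. -/
@[route_item "route-HubbardSuperconductivity-IntrinsicLargeN"]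
def RotorPairRemoval : Prop :=
  ∀ δ ∈ Set.Ioo (0:ℝ) (1/2), ∀ γ U₁ : ℝ, 0 < γ → 0 < U₁ → (∀ U ∈ Set.Ioo (0:ℝ) U₁, Literature.MathematicalPhysics.QuantumLattice.channelInf (Literature.MathematicalPhysics.QuantumLattice.squareDispersion 1 0) (Literature.MathematicalPhysics.QuantumLattice.chemicalPotentialOfDensity (Literature.MathematicalPhysics.QuantumLattice.squareDispersion 1 0) (1 - δ)) U Literature.MathematicalPhysics.QuantumLattice.D4Irrep.B1g ≤ -(γ * U ^ 2) ∧ ∀ χ : Literature.MathematicalPhysics.QuantumLattice.D4Irrep, χ ≠ Literature.MathematicalPhysics.QuantumLattice.D4Irrep.B1g → Literature.MathematicalPhysics.QuantumLattice.channelInf (Literature.MathematicalPhysics.QuantumLattice.squareDispersion 1 0) (Literature.MathematicalPhysics.QuantumLattice.chemicalPotentialOfDensity (Literature.MathematicalPhysics.QuantumLattice.squareDispersion 1 0) (1 - δ)) U Literature.MathematicalPhysics.QuantumLattice.D4Irrep.B1g + γ * U ^ 2 ≤ Literature.MathematicalPhysics.QuantumLattice.channelInf (Literature.MathematicalPhysics.QuantumLattice.squareDispersion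 1 0) (Literature.MathematicalPhysics.QuantumLattice.chemicalPotentialOfDensity (Literature.MathematicalPhysics.QuantumLattice.squareDispersion 1 0) (1 - δ)) U χ) → ∃ U₀ : ℝ, 0 < U₀ ∧ ∀ U ∈ Set.Ioo (0:ℝ) U₀, ∀ η : ℝ, 0 < η → ∃ L₀ : ℕ, ∀ (L : ℕ) [NeZero L], L₀ ≤ L → Even L → ∀ ψ : Literature.MathematicalPhysics.QuantumLattice.Fock (Literature.MathematicalPhysics.QuantumLattice.Orb (Literature.MathematicalPhysics.QuantumLattice.FermionTorus 2 L)), star ψ ⬝ᵥ ψ = 1 → Literature.MathematicalPhysics.QuantumLattice.IsGroundStateInSector (Literature.MathematicalPhysics.QuantumLattice.hubbardTorus 2 L 1 U) (2 * ⌊(1 - δ) * (L : ℝ) ^ 2 / 2⌋₊) 0 ψ → (Literature.MathematicalPhysics.QuantumLattice.expect ((Literature.MathematicalPhysics.QuantumLattice.pairField Literature.MathematicalPhysics.QuantumLattice.dWaveFormFactor L)ᴴ * Literature.MathematicalPhysics.QuantumLattice.hubbardTorus 2 L 1 U * Literature.MathematicalPhysics.QuantumLattice.pairField Literature.MathematicalPhysics.QuantumLattice.dWaveFormFactor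 L) ψ).re ≤ ((Literature.MathematicalPhysics.QuantumLattice.hubbardTorus 2 L 1 U).minEnergyOn (Literature.MathematicalPhysics.QuantumLattice.szSector (2 * ⌊(1 - δ) * (L : ℝ) ^ 2 / 2⌋₊ - 2) 0) + η) * (Literature.MathematicalPhysics.QuantumLattice.expect ((Literature.MathematicalPhysics.QuantumLattice.pairField Literature.MathematicalPhysics.QuantumLattice.dWaveFormFactor L)ᴴ * Literature.MathematicalPhysics.QuantumLattice.pairField Literature.MathematicalPhysics.QuantumLattice.dWaveFormFactor L) ψ).re

-- earlier Assembly (stmt-HubbardSuperconductivity-1662, replaced 2026-08-15T16:31:32Z -> stmt-HubbardSuperconductivity-10969): retired by None — KohnLuttingerB1gPoint → ReducedBCSAnchor → OneOverNTransfer → HubbardSuperconductivity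
/-- item stmt-HubbardSuperconductivity-10969 · assembly · rank 1 · closed · proved by Summit.HubbardSuperconductivity.HubbardSuperconductivity.Theorems.IntrinsicLargeN.intrinsicLargeN_assembly_proof (prover) · by planner
sources: Scalapino1995
[assembly] KohnLuttingerB1gPoint → ReducedBCSAnchor → PairSectorShadow → GroundEigenspaceHomogeneity
→ ShadowCondensation → UniformLROGivesSummitMatrix → HubbardSuperconductivity (rev 2): literally the
type of the deciding theorem `closes` (proved, rc 0): take δ, γ, U₁ from the KL item; κ, U₀ from
PairSectorShadow and U₀′ from GroundEigenspaceHomogeneity at that δ; U := min(U₀,U₀′)/2; g ≥ κU² >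
0, ε, θ, L₁ from the shadow; c, L₃ from the anchor at (g, δ) (δ < 1/2 < 1); θ′, L₂ from homogeneity;
a := (1−θ′)(1−θ)(1−ε)c/g, L₀ := max; for a ground state ψ: ShadowCondensation (with c·L²) bounds the
shadow's LRO below, clause (ii) transfers it to ψ₀, homogeneity to ψ; UniformLROGivesSummitMatrix
turns the uniform bound into the summit matrix at (U, δ). -/
@[route_item "route-HubbardSuperconductivity-IntrinsicLargeN"]
def Assembly : Prop :=
  KohnLuttingerB1gPoint → ReducedBCSAnchor → PairSectorShadow → GroundEigenspaceHomogeneity → ShadowCondensation → UniformLROGivesSummitMatrix → HubbardSuperconductivity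

/-! D-0027 §2.1 — DECIDING THEOREM (planner-authored via `route open/edit --closes-file`; by planner-rbadge-HubbardSuperconductivity-Intrin-0f86bff1-g2-0 2026-08-15T16:31:32Z):
its hypotheses are this route's items and its conclusion the sub-problem Statement (glue_lint), and it elaborates with this file. -/

@[closes "route-HubbardSuperconductivity-IntrinsicLargeN"] theorem closes (hKL : KohnLuttingerB1gPoint) (hA : ReducedBCSAnchor) (h1 : PairSectorShadow)
    (h2 : GroundEigenspaceHomogeneity) (h3 : ShadowCondensation) (hG : UniformLROGivesSummitMatrix) :
    HubbardSuperconductivity := by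
  obtain ⟨δ, hδ, γ, U₁, hγ, hU₁, hdom⟩ := hKL
  have hδ1 : δ ∈ Set.Ioo (0:ℝ) 1 := ⟨hδ.1, by linarith [hδ.2]⟩
  obtain ⟨κ, hκ, U₂, hU₂, hS⟩ := h1 δ hδ γ U₁ hγ hU₁ hdom
  obtain ⟨U₃, hU₃, hH⟩ := h2 δ hδ γ U₁ hγ hU₁ hdom
  have hm : 0 < min U₂ U₃ := lt_min hU₂ hU₃
  set U : ℝ := min U₂ U₃ / 2 with hUdef
  have hUpos : 0 < U := by rw [hUdef]; positivity
  have hUlt : U < min U₂ U₃ := by rw [hUdef]; exact half_lt_self hm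
  have hU2 : U ∈ Set.Ioo (0:ℝ) U₂ := ⟨hUpos, lt_of_lt_of_le hUlt (min_le_left _ _)⟩
  have hU3 : U ∈ Set.Ioo (0:ℝ) U₃ := ⟨hUpos, lt_of_lt_of_le hUlt (min_le_right _ _)⟩
  obtain ⟨g, hg, ε, θ, hε, hθ, L₁, hL₁⟩ := hS U hU2
  obtain ⟨θ', hθ', L₂, hL₂⟩ := hH U hU3
  have hκU : 0 < κ * U ^ 2 := by positivity
  have hgpos : 0 < g := lt_of_lt_of_le hκU hg
  obtain ⟨c, hc, L₃, hL₃⟩ := hA g hgpos δ hδ1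
  have h1' : 0 < 1 - θ' := by linarith
  have h2' : 0 < 1 - θ := by linarith
  have h3' : 0 < 1 - ε := by linarith
  have hX : ∃ a : ℝ, 0 < a ∧ ∃ L₀ : ℕ, ∀ (L : ℕ) [NeZero L], L₀ ≤ L → Even L →
      ∀ ψ : Literature.MathematicalPhysics.QuantumLattice.Fock (Literature.MathematicalPhysics.QuantumLattice.Orb (Literature.MathematicalPhysics.QuantumLattice.FermionTorus 2 L)),
        star ψ ⬝ᵥ ψ = 1 →
        Literature.MathematicalPhysics.QuantumLattice.IsGroundStateInSector (Literature.MathematicalPhysics.QuantumLattice.hubbardTorus 2 L 1 U) (2 * ⌊(1 - δ) * (L : ℝ) ^ 2 / 2⌋₊) 0 ψ →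
        a * (L : ℝ) ^ 4 ≤ (Literature.MathematicalPhysics.QuantumLattice.expect ((Literature.MathematicalPhysics.QuantumLattice.pairField Literature.MathematicalPhysics.QuantumLattice.dWaveFormFactor L)ᴴ * Literature.MathematicalPhysics.QuantumLattice.pairField Literature.MathematicalPhysics.QuantumLattice.dWaveFormFactor L) ψ).re := by
    refine ⟨(1 - θ') * ((1 - θ) * ((1 - ε) * (c / g))), by positivity, max L₁ (max L₂ L₃), ?_⟩
    intro L inst hL hEven ψ hψ hGS
    have hL1 : L₁ ≤ L := le_trans (le_max_left _ _) hL
    have hL2 : L₂ ≤ L := le_trans (le_trans (le_max_left _ _) (le_max_right _ _)) hL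
    have hL3 : L₃ ≤ L := le_trans (le_trans (le_max_right _ _) (le_max_right _ _)) hL
    obtain ⟨ψ₀, hψ₀, hGS₀, φ, hφS, hφ1, hφE, hφLRO⟩ := hL₁ L hL1 hEven
    have hanchor := hL₃ L hL3 hEven
    have h3c := h3 g hgpos L (2 * ⌊(1 - δ) * (L : ℝ) ^ 2 / 2⌋₊) (c * (L : ℝ) ^ 2) ε φ hε.le hφ1 hφS hanchor hφE
    have hhom := hL₂ L hL2 hEven ψ ψ₀ hψ hψ₀ hGS hGS₀
    calc (1 - θ') * ((1 - θ) * ((1 - ε) * (c / g))) * (L : ℝ) ^ 4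
        = (1 - θ') * ((1 - θ) * ((1 - ε) * ((L : ℝ) ^ 2 * (c * (L : ℝ) ^ 2) / g))) := by ring
      _ ≤ (1 - θ') * ((1 - θ) * (Literature.MathematicalPhysics.QuantumLattice.expect ((Literature.MathematicalPhysics.QuantumLattice.pairField Literature.MathematicalPhysics.QuantumLattice.dWaveFormFactor L)ᴴ * Literature.MathematicalPhysics.QuantumLattice.pairField Literature.MathematicalPhysics.QuantumLattice.dWaveFormFactor L) φ).re) :=
          mul_le_mul_of_nonneg_left (mul_le_mul_of_nonneg_left h3c h2'.le) h1'.le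
      _ ≤ (1 - θ') * (Literature.MathematicalPhysics.QuantumLattice.expect ((Literature.MathematicalPhysics.QuantumLattice.pairField Literature.MathematicalPhysics.QuantumLattice.dWaveFormFactor L)ᴴ * Literature.MathematicalPhysics.QuantumLattice.pairField Literature.MathematicalPhysics.QuantumLattice.dWaveFormFactor L) ψ₀).re := mul_le_mul_of_nonneg_left hφLRO h1'.le
      _ ≤ _ := hhom
  unfold HubbardSuperconductivity Literature.Hubbard.DWaveSuperconductivityHubbard
  exact ⟨U, hUpos, δ, hδ, hG U δ hX⟩

end Summit.HubbardSuperconductivity.HubbardSuperconductivity.Theses.IntrinsicLargeN
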